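import Summits.ResolutionOfSingularities.ResolutionOfSingularities.Theorems.HigherRankTermination.Negative.ValuationRingFixedPoint

/-!
# `HigherRankTermination` (crux stmt-ResolutionOfSingularities-17045, route `SyzygyFlattening`):
# the binder `A.FG` of its conclusion is load-bearing
# (negative-side support, refuter cdisprove seat; does NOT refute the crux)

Companion of `Negative/ValuationRingFixedPoint.lean` (valuation rings are fixed points of the route's
operator: `tower_valuationSubring`). Here the witness and the two negative lemmas, sorry-free:

* `HK = 𝔽_p((t^{ℤ ×ₗ ℤ}))` (Hahn series), `HO` = its valuation ring `{0 ≤ orderTop}`, `HA = HO` as an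
  `𝔽_p`-subalgebra; `algebraMap_mem_HO`, `isFractionRing_HA`, `dimZero_HO` (residue field `𝔽_p`: every
  `y ∈ O` is congruent to its constant term) — the binders of the crux's conclusion except `A.FG`;
* `not_isNoetherianRing_HA` — `(t^{(1,0)}) ⊊ (t^{(1,-1)}) ⊊ (t^{(1,-2)}) ⊊ ⋯`;
* `two_le_ringKrullDim_HO`, `ringKrullDim_HO_ne_one` — `⊥ < 𝔭 < 𝔪` with `𝔭 = primeP` the series
  whose order exceeds every `(0, n)`; so the witness is OFF the rank-one hypothesis of the crux;
* `dimZeroTermination_false_without_FG`, `offRankOne_false_without_FG` — the conclusion of the crux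
  (resp. its off-rank-one part `ringKrullDim O ≠ 1`, the part `HigherRankTermination` adds to
  `RankOneTermination`) with the single binder `A.FG` deleted is FALSE at every prime `p`: the tower is
  constantly `O` (fixed point), which is not Noetherian, hence never regular.

Moral for provers: finite generation of the models must be used by any proof of the crux; for the
disprover: no loop of the operator can come from the valuation ring alone.
-/

noncomputable section

set_option linter.dupNamespace false

namespace Summit.ResolutionOfSingularities.ResolutionOfSingularities.Theorems.HigherRankTermination.Negative

/-! ## The witness: the Hahn valuation ring of `𝔽_p((t^{ℤ ×ₗ ℤ}))` -/

section Witness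

variable (p : ℕ) [hp : Fact p.Prime]

/-- The value group `ℤ ×ₗ ℤ` (rank two). -/
abbrev Γ : Type := ℤ ×ₗ ℤ

/-- The field `K = 𝔽_p((t^Γ))` of Hahn series. -/
abbrev HK : Type := HahnSeries Γ (ZMod p)

/-- The Hahn valuation (as a `Valuation`). -/
abbrev hahnVal : Valuation (HK p) (Multiplicative (WithTop Γ)ᵒᵈ) :=
  AddValuation.toValuation (HahnSeries.addVal Γ (ZMod p))

/-- Its valuation ring `O = {x | 0 ≤ orderTop x}`. -/
abbrev HO : ValuationSubring (HK p) := (hahnVal p).valuationSubring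

/-- `O = {x | 0 ≤ orderTop x}`. -/
theorem mem_HO_iff (x : HK p) : x ∈ HO p ↔ (0 : WithTop Γ) ≤ x.orderTop := by
  change (hahnVal p) x ≤ 1 ↔ _
  rw [show (1 : Multiplicative (WithTop Γ)ᵒᵈ) = Multiplicative.ofAdd (OrderDual.toDual 0) from rfl]
  simp only [hahnVal, AddValuation.toValuation_apply, HahnSeries.addVal_apply, Multiplicative.ofAdd_le,
    OrderDual.toDual_le_toDual]

/-- `v x < 1 ↔ 0 < orderTop x`. -/
theorem hahnVal_lt_one_iff (x : HK p) : hahnVal p x < 1 ↔ (0 : WithTop Γ) < x.orderTop := by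
  rw [show (1 : Multiplicative (WithTop Γ)ᵒᵈ) = Multiplicative.ofAdd (OrderDual.toDual 0) from rfl]
  simp only [hahnVal, AddValuation.toValuation_apply, HahnSeries.addVal_apply, Multiplicative.ofAdd_lt,
    OrderDual.toDual_lt_toDual]

/-- Monomials of non-negative degree lie in `O`. -/
theorem single_mem_HO {g : Γ} (hg : 0 ≤ g) (c : ZMod p) : HahnSeries.single g c ∈ HO p := by
  rw [mem_HO_iff]
  exact (WithTop.coe_le_coe.mpr hg).trans HahnSeries.orderTop_single_le

/-- Constants lie in `O`. -/
theorem algebraMap_mem_HO (c : ZMod p) : algebraMap (ZMod p) (HK p) c ∈ HO p := by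
  rw [← HahnSeries.C_eq_algebraMap, HahnSeries.C_apply]
  exact single_mem_HO p le_rfl c

/-- `A = O` as an `𝔽_p`-subalgebra. -/
abbrev HA : Subalgebra (ZMod p) (HK p) := valuationSubalgebra (HO p) (algebraMap_mem_HO p)

/-- `K = Frac O` (valuation ring). -/
theorem isFractionRing_HA : IsFractionRing ↥(HA p) (HK p) := by
  rw [IsFractionRing, isLocalization_iff]
  refine ⟨?_, ?_, ?_⟩
  · intro y
    apply IsUnit.mk0
    intro h
    apply nonZeroDivisors.ne_zero y.2
    exact Subtype.ext h
  · intro z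
    by_cases hz : z ∈ HO p
    · exact ⟨(⟨z, hz⟩, 1), by simp⟩
    · have hz' : z⁻¹ ∈ HO p := (ValuationSubring.mem_or_inv_mem _ z).resolve_left hz
      have hz0 : z ≠ 0 := by
        rintro rfl
        exact hz (HO p).zero_mem
      have hzi0 : (⟨z⁻¹, hz'⟩ : ↥(HA p)) ≠ 0 := by
        intro h
        have : z⁻¹ = 0 := congrArg Subtype.val h
        exact hz0 (inv_eq_zero.mp this)
      refine ⟨(1, ⟨⟨z⁻¹, hz'⟩, mem_nonZeroDivisors_of_ne_zero hzi0⟩), ?_⟩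
      simp [mul_inv_cancel₀ hz0]
  · intro x y h
    exact ⟨1, by simpa using Subtype.val_injective h⟩

/-- The residue field of `O` is `𝔽_p`: every `y ∈ O` is congruent to its constant term. -/
theorem dimZero_HO (y : HK p) (hy : y ∈ HO p) :
    ∃ f : Polynomial (ZMod p), f ≠ 0 ∧ (HO p).valuation (Polynomial.aeval y f) < 1 := by
  refine ⟨Polynomial.X - Polynomial.C (y.coeff 0), Polynomial.X_sub_C_ne_zero _, ?_⟩
  have hz : Polynomial.aeval y (Polynomial.X - Polynomial.C (y.coeff 0)) =
      y - HahnSeries.single 0 (y.coeff 0) := by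
    simp [← HahnSeries.C_eq_algebraMap]
  rw [hz, ← (Valuation.isEquiv_valuation_valuationSubring (hahnVal p)).lt_one_iff_lt_one,
    hahnVal_lt_one_iff]
  set z : HK p := y - HahnSeries.single 0 (y.coeff 0) with hzdef
  have hy0 : (0 : WithTop Γ) ≤ y.orderTop := (mem_HO_iff p y).mp hy
  -- all coefficients of `z` in degrees `≤ 0` vanish
  have hcoeff : ∀ j : Γ, j ≤ 0 → z.coeff j = 0 := by
    intro j hj
    rcases hj.lt_or_eq with hj | rfl
    · have h1 : y.coeff j = 0 := HahnSeries.coeff_eq_zero_of_lt_orderTop ((WithTop.coe_lt_coe.mpr hj).trans_le hy0)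
      have h2 : (HahnSeries.single (0 : Γ) (y.coeff 0)).coeff j = 0 :=
        HahnSeries.coeff_single_of_ne hj.ne
      simp [hzdef, h1, h2]
    · simp [hzdef]
  have hge : (0 : WithTop Γ) ≤ z.orderTop :=
    HahnSeries.le_orderTop_iff_forall.mpr fun j hj => hcoeff j (WithTop.coe_lt_coe.mp hj).le
  rcases hge.lt_or_eq with h | h
  · exact h
  · exfalso
    exact HahnSeries.coeff_orderTop_ne h.symm (hcoeff 0 le_rfl)

/-- `t^g` for `g ∈ Γ`, `g ≥ 0`, as an element of `A = O`. -/
def tA (g : Γ) (hg : 0 ≤ g) : ↥(HA p) := ⟨HahnSeries.single g 1, single_mem_HO p hg 1⟩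

/-- `(1, -n) ≥ 0` lexicographically. -/
theorem nonneg_one_neg (n : ℕ) : (0 : Γ) ≤ toLex ((1 : ℤ), -(n : ℤ)) :=
  (Prod.Lex.toLex_le_toLex).mpr (Or.inl (by simp))

/-- The chain of principal ideals `(t^{(1,-n)})`, increasing in `n`. -/
def chain : ℕ →o Ideal ↥(HA p) where
  toFun n := Ideal.span {tA p (toLex ((1 : ℤ), -(n : ℤ))) (nonneg_one_neg n)}
  monotone' := by
    refine monotone_nat_of_le_succ fun n => ?_
    rw [Ideal.span_singleton_le_span_singleton]
    refine ⟨tA p (toLex ((0 : ℤ), (1 : ℤ))) ((Prod.Lex.toLex_le_toLex).mpr (Or.inr ⟨rfl, by simp⟩)), ?_⟩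
    apply Subtype.ext
    have he : toLex ((1 : ℤ), -((n + 1 : ℕ) : ℤ)) + toLex ((0 : ℤ), (1 : ℤ)) = (toLex ((1 : ℤ), -(n : ℤ)) : Γ) := by
      show toLex (((1 : ℤ), -((n + 1 : ℕ) : ℤ)) + ((0 : ℤ), (1 : ℤ))) = toLex ((1 : ℤ), -(n : ℤ))
      rw [Prod.mk_add_mk]
      congr 1
      · push_cast; ring
    show HahnSeries.single _ (1 : ZMod p) = HahnSeries.single _ 1 * HahnSeries.single _ 1
    rw [HahnSeries.single_mul_single, mul_one, he]

/-- The chain is strictly increasing: `t^{(1,-n)} ∤ t^{(1,-n-1)}` in `O`. -/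
theorem chain_ne (n : ℕ) : chain p n ≠ chain p (n + 1) := by
  intro h
  have hle : chain p (n + 1) ≤ chain p n := h.symm.le
  change Ideal.span {tA p (toLex ((1 : ℤ), -((n + 1 : ℕ) : ℤ))) _} ≤
    Ideal.span {tA p (toLex ((1 : ℤ), -(n : ℤ))) _} at hle
  rw [Ideal.span_singleton_le_span_singleton] at hle
  obtain ⟨c, hc⟩ := hle
  have hcK : (HahnSeries.single (toLex ((1 : ℤ), -((n + 1 : ℕ) : ℤ))) (1 : ZMod p) : HK p) =
      HahnSeries.single (toLex ((1 : ℤ), -(n : ℤ))) 1 * (c : HK p) := congrArg Subtype.val hc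
  have hord := congrArg HahnSeries.orderTop hcK
  rw [HahnSeries.orderTop_mul, HahnSeries.orderTop_single one_ne_zero,
    HahnSeries.orderTop_single one_ne_zero] at hord
  have hc0 : (0 : WithTop Γ) ≤ (c : HK p).orderTop := (mem_HO_iff p _).mp c.2
  have hle' : ((toLex ((1 : ℤ), -(n : ℤ)) : Γ) : WithTop Γ) ≤ (toLex ((1 : ℤ), -((n + 1 : ℕ) : ℤ)) : Γ) := by
    rw [hord]
    exact le_add_of_nonneg_right hc0
  have := (Prod.Lex.toLex_le_toLex).mp (WithTop.coe_le_coe.mp hle')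
  rcases this with h | ⟨-, h⟩
  · exact lt_irrefl _ h
  · push_cast at h
    omega

/-- `A = O` is not Noetherian, hence no stage of the (constant) tower is regular. -/
theorem not_isNoetherianRing_HA : ¬ IsNoetherianRing ↥(HA p) := by
  intro hN
  obtain ⟨n, hn⟩ := (monotone_stabilizes_iff_noetherian.mpr hN) (chain p)
  exact chain_ne p n (hn (n + 1) (Nat.le_succ n))

/-- Membership in the maximal ideal of `O` is positivity of the order. -/
theorem mem_maximalIdeal_HO_iff (x : ↥(HO p)) :
    x ∈ IsLocalRing.maximalIdeal ↥(HO p) ↔ (0 : WithTop Γ) < (x : HK p).orderTop := by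
  rw [ValuationSubring.valuation_lt_one_iff,
    ← (Valuation.isEquiv_valuation_valuationSubring (hahnVal p)).lt_one_iff_lt_one, hahnVal_lt_one_iff]

/-- The height-one prime of `O`: series whose order exceeds every `(0, n)`. -/
def primeP : Ideal ↥(HO p) where
  carrier := {x | ∀ n : ℕ, ((toLex ((0 : ℤ), (n : ℤ)) : Γ) : WithTop Γ) < (x : HK p).orderTop}
  add_mem' := by
    intro a b ha hb n
    exact (lt_min (ha n) (hb n)).trans_le (by push_cast; exact HahnSeries.min_orderTop_le_orderTop_add)
  zero_mem' := by
    intro n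
    simp
  smul_mem' := by
    intro c x hx n
    have hc : (0 : WithTop Γ) ≤ (c : HK p).orderTop := (mem_HO_iff p _).mp c.2
    show _ < ((c : HK p) * (x : HK p)).orderTop
    rw [HahnSeries.orderTop_mul]
    exact (hx n).trans_le (le_add_of_nonneg_left hc)

/-- Membership in `𝔭`. -/
theorem mem_primeP_iff (x : ↥(HO p)) :
    x ∈ primeP p ↔ ∀ n : ℕ, ((toLex ((0 : ℤ), (n : ℤ)) : Γ) : WithTop Γ) < (x : HK p).orderTop :=
  Iff.rfl

/-- `𝔭` is prime. -/
theorem primeP_isPrime : (primeP p).IsPrime := by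
  refine ⟨?_, ?_⟩
  · rw [Ideal.ne_top_iff_one]
    intro h
    have := (mem_primeP_iff p 1).mp h 0
    rw [show (((toLex ((0 : ℤ), ((0 : ℕ) : ℤ))) : Γ) : WithTop Γ) = 0 from rfl] at this
    push_cast at this
    rw [HahnSeries.orderTop_one] at this
    exact lt_irrefl _ this
  · intro x y hxy
    by_contra h
    push Not at h
    obtain ⟨hx, hy⟩ := h
    simp only [mem_primeP_iff, not_forall, not_lt] at hx hy
    obtain ⟨n, hn⟩ := hx
    obtain ⟨m, hm⟩ := hy
    have h1 := (mem_primeP_iff p _).mp hxy (n + m)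
    have hxy' : ((x * y : ↥(HO p)) : HK p).orderTop = (x : HK p).orderTop + (y : HK p).orderTop := by
      push_cast
      exact HahnSeries.orderTop_mul _ _
    rw [hxy'] at h1
    have h3 : (x : HK p).orderTop + (y : HK p).orderTop ≤
        (((toLex ((0 : ℤ), (n : ℤ))) : Γ) : WithTop Γ) + (((toLex ((0 : ℤ), (m : ℤ))) : Γ) : WithTop Γ) :=
      add_le_add hn hm
    have hΓ : (toLex ((0 : ℤ), (n : ℤ)) : Γ) + toLex ((0 : ℤ), (m : ℤ)) = toLex ((0 : ℤ), ((n + m : ℕ) : ℤ)) := by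
      show toLex (((0 : ℤ), (n : ℤ)) + ((0 : ℤ), (m : ℤ))) = toLex ((0 : ℤ), ((n + m : ℕ) : ℤ))
      rw [Prod.mk_add_mk, add_zero]
      simp
    have h4 : (((toLex ((0 : ℤ), (n : ℤ))) : Γ) : WithTop Γ) + (((toLex ((0 : ℤ), (m : ℤ))) : Γ) : WithTop Γ) =
        (((toLex ((0 : ℤ), ((n + m : ℕ) : ℤ))) : Γ) : WithTop Γ) := by
      rw [← WithTop.coe_add, hΓ]
    exact lt_irrefl _ (h1.trans_le (h3.trans_eq h4))

/-- `t^{(1,0)} ∈ 𝔭`, so `⊥ < 𝔭`. -/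
theorem bot_lt_primeP : (⊥ : Ideal ↥(HO p)) < primeP p := by
  refine bot_lt_iff_ne_bot.mpr fun h => ?_
  have hmem : (⟨HahnSeries.single (toLex ((1 : ℤ), (0 : ℤ))) 1,
      single_mem_HO p (g := toLex ((1 : ℤ), (0 : ℤ)))
        ((Prod.Lex.toLex_le_toLex (x := ((0 : ℤ), (0 : ℤ)))).mpr (Or.inl (by simp))) 1⟩ : ↥(HO p)) ∈ primeP p := by
    intro n
    push_cast
    rw [HahnSeries.orderTop_single one_ne_zero, WithTop.coe_lt_coe]
    exact (Prod.Lex.toLex_lt_toLex).mpr (Or.inl (by simp))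
  rw [h, Ideal.mem_bot] at hmem
  have := congrArg Subtype.val hmem
  simp at this

/-- `t^{(0,1)} ∈ 𝔪 ∖ 𝔭`, so `𝔭 < 𝔪`. -/
theorem primeP_lt_maximalIdeal : primeP p < IsLocalRing.maximalIdeal ↥(HO p) := by
  refine lt_of_le_of_ne ?_ ?_
  · intro x hx
    rw [mem_maximalIdeal_HO_iff]
    have := (mem_primeP_iff p x).mp hx 0
    rwa [show (((toLex ((0 : ℤ), ((0 : ℕ) : ℤ))) : Γ) : WithTop Γ) = 0 from rfl] at this
  · intro h
    have hmem : (⟨HahnSeries.single (toLex ((0 : ℤ), (1 : ℤ))) 1,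
        single_mem_HO p (g := toLex ((0 : ℤ), (1 : ℤ)))
          ((Prod.Lex.toLex_le_toLex (x := ((0 : ℤ), (0 : ℤ)))).mpr (Or.inr ⟨rfl, by simp⟩)) 1⟩ : ↥(HO p)) ∈
        IsLocalRing.maximalIdeal ↥(HO p) := by
      rw [mem_maximalIdeal_HO_iff]
      push_cast
      rw [HahnSeries.orderTop_single one_ne_zero, WithTop.coe_pos]
      exact (Prod.Lex.toLex_lt_toLex).mpr (Or.inr ⟨rfl, by simp⟩)
    rw [← h, mem_primeP_iff] at hmem
    have := hmem 1
    push_cast at this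
    rw [HahnSeries.orderTop_single one_ne_zero, WithTop.coe_lt_coe] at this
    have := (Prod.Lex.toLex_lt_toLex).mp this
    simp at this

/-- `O` has Krull dimension ≥ 2 (so it is OFF the rank-one hypothesis of the crux). -/
theorem two_le_ringKrullDim_HO : (2 : WithBot ℕ∞) ≤ ringKrullDim ↥(HO p) := by
  haveI := primeP_isPrime p
  let s : LTSeries (PrimeSpectrum ↥(HO p)) :=
    { length := 2
      toFun := ![⟨⊥, Ideal.isPrime_bot⟩, ⟨primeP p, primeP_isPrime p⟩,
        ⟨IsLocalRing.maximalIdeal ↥(HO p), (IsLocalRing.maximalIdeal.isMaximal _).isPrime⟩]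
      step := by
        intro i
        fin_cases i
        · exact bot_lt_primeP p
        · exact primeP_lt_maximalIdeal p }
  exact Order.LTSeries.length_le_krullDim s

/-- Hence `ringKrullDim O ≠ 1`. -/
theorem ringKrullDim_HO_ne_one : ringKrullDim ↥(HO p) ≠ 1 := by
  intro h
  have := two_le_ringKrullDim_HO p
  rw [h] at this
  exact absurd this (by decide)

end Witness

/-! ## The negative lemmas -/

/-- **`A.FG` is load-bearing for the conclusion of `HigherRankTermination` (every prime `p`).**
The conclusion of the crux — termination of the route's tower along every dimension-zero valuation
ring `O ⊇ k` of `K = Frac A` — with the single binder `A.FG` deleted is FALSE: along the rank-two Hahn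
valuation of `𝔽_p((t^{ℤ ×ₗ ℤ}))` (residue field `𝔽_p`), started at `A = O`, the tower is constantly
`O` (`tower_valuationSubring`), which is not Noetherian. This does NOT refute the crux (whose models
are finitely generated); it shows where finite generation must enter any proof, and that the
operator cannot loop "because of the valuation". -/
theorem dimZeroTermination_false_without_FG (p : ℕ) [Fact p.Prime] :
    ¬ (∀ (k K : Type) [Field k] [CharP k p] [Field K] [Algebra k K] (O : ValuationSubring K)
        (A : Subalgebra k K), (∀ c : k, algebraMap k K c ∈ O) → IsFractionRing ↥A K →
        A.toSubring ≤ O.toSubring →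
        (∀ y : K, y ∈ O → ∃ f : Polynomial k, f ≠ 0 ∧ O.valuation (Polynomial.aeval y f) < 1) →
        ∃ m : ℕ, IsRegularLocalRing ↥(tower k K O A m)) := by
  intro H
  obtain ⟨m, hm⟩ := H (ZMod p) (HK p) (HO p) (HA p) (algebraMap_mem_HO p) (isFractionRing_HA p)
    le_rfl (dimZero_HO p)
  rw [tower_valuationSubring] at hm
  haveI : IsRegularLocalRing ↥(HA p) := hm
  exact not_isNoetherianRing_HA p inferInstance

/-- **`A.FG` is load-bearing already for the OFF-RANK-ONE part of the conclusion** — the part that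
`HigherRankTermination` adds to its hypothesis `RankOneTermination` (valuation rings of Krull
dimension `≠ 1`): the same rank-two Hahn witness has `ringKrullDim O ≥ 2`. -/
theorem offRankOne_false_without_FG (p : ℕ) [Fact p.Prime] :
    ¬ (∀ (k K : Type) [Field k] [CharP k p] [Field K] [Algebra k K] (O : ValuationSubring K)
        (A : Subalgebra k K), (∀ c : k, algebraMap k K c ∈ O) → IsFractionRing ↥A K →
        A.toSubring ≤ O.toSubring →
        (∀ y : K, y ∈ O → ∃ f : Polynomial k, f ≠ 0 ∧ O.valuation (Polynomial.aeval y f) < 1) →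
        ringKrullDim ↥O ≠ 1 → ∃ m : ℕ, IsRegularLocalRing ↥(tower k K O A m)) := by
  intro H
  obtain ⟨m, hm⟩ := H (ZMod p) (HK p) (HO p) (HA p) (algebraMap_mem_HO p) (isFractionRing_HA p)
    le_rfl (dimZero_HO p) (ringKrullDim_HO_ne_one p)
  rw [tower_valuationSubring] at hm
  haveI : IsRegularLocalRing ↥(HA p) := hm
  exact not_isNoetherianRing_HA p inferInstance

end Summit.ResolutionOfSingularities.ResolutionOfSingularities.Theorems.HigherRankTermination.Negative

end
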